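import Summits.RiemannHypothesis.RiemannHypothesis.Theses.Strip
import Summits.RiemannHypothesis.RiemannHypothesis.Theorems.RuelleBandNribWeakRecurrenceToExactIff
import Literature.NumberTheory.LFunctions.QuasiRHFactsProofs

/-!
# Crux-strategist sketch — `Strip.StripThesis` (stmt-RiemannHypothesis-10635), RESTATED deciding crux

Typed record of the decompositions examined for the BC2-redirect audit of route `Strip`
(companion of `Cruxes/StripThesis/STRATEGY-CENSUS.md`). Everything here is PROVED (no `sorry`):

* §0  calibration `StripThesis ↔ RiemannHypothesis` (Titchmarsh §2.12; in-tree via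
      `riemannHypothesis_of_forall_quasiRiemannHypothesis` + `quasiRiemannHypothesis_one_half_iff_holds`);
* D-A the abscissa BRIDGE split `X ⟸ StripZeroFreeStrip ∧ (StripZeroFreeStrip → X)` (trivial seam)
      and its equivalent DICHOTOMY form "Θ⁺ ∉ (1/2, 1)";
* D-M the Mertens ε-form `MertensHalf ↔ X` — a LANDED iff (Littlewood 1912 / Titchmarsh Thm 14.25,
      `mertens_isBigO_iff_forall_quasiRiemannHypothesis`), i.e. restated one level down;
* D-O the one-sided halves of the Mertens bound (assembly proved; each half alone is RH-equivalent
      by Montgomery–Vaughan Thm 15.2 / (15.10), Landau's Lemma 15.1 — not in tree, recorded in the census);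
* D-H the height split `RHUpToAbs T ∧ RHAbove T → X`;
* D-R route RuelleBand's redirect transported: `X ↔ NoRightInteriorBand ∧ ZetaWeakRecurrence`
      (landed `riemannHypothesis_iff_noRightInteriorBand_and_weakRecurrence`).

Probes (`bc/probes.lean`) are run on the piece DEFINITIONS in `bc/Pieces.lean`, which this file
re-uses by `open`.
-/

set_option linter.dupNamespace false

noncomputable section

namespace Summit.RiemannHypothesis.RiemannHypothesis.Cruxes.StripThesis.Strategist

open Complex Filter Asymptotics
open Summit.RiemannHypothesis.RiemannHypothesis.Theses.Strip
open Summit.RiemannHypothesis.RiemannHypothesis.Theses.RuelleBand (NoRightInteriorBand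
  ZetaWeakRecurrence)
open Literature.NumberTheory.LFunctions (QuasiRiemannHypothesis mertensFunction
  riemannHypothesis_of_forall_quasiRiemannHypothesis quasiRiemannHypothesis_one_half_iff_holds
  mertens_isBigO_iff_forall_quasiRiemannHypothesis)

/-! ## Piece definitions (verbatim copies of `bc/Pieces.lean`, kept here so this file is self-contained) -/

/-- D-A bridge piece: a zero-free strip at the edge `Re s = 1` propagates to the critical line. -/
def StripPropagation : Prop := StripZeroFreeStrip → StripThesis

/-- D-A dichotomy form, "Θ⁺ ∉ (1/2, 1)": quasi-RH at one abscissa `σ₀ ∈ (1/2,1)` forces X. -/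
def StripDichotomy : Prop :=
  ∀ σ₀ : ℝ, 1 / 2 < σ₀ → σ₀ < 1 → QuasiRiemannHypothesis σ₀ → StripThesis

/-- D-M: `M(x) ≪_ε x^{1/2+ε}` for every `ε > 0` (Mertens sum written over Mathlib as in the route). -/
def MertensHalf : Prop :=
  ∀ ε : ℝ, 0 < ε →
    (fun x : ℝ => ((∑ n ∈ Finset.Ioc 0 ⌊x⌋₊, ArithmeticFunction.moebius n : ℤ) : ℝ)) =O[atTop]
      fun x : ℝ => x ^ (1 / 2 + ε)

/-- D-O upper half: `M(x) ≤ x^{1/2+ε}` eventually, for every `ε > 0`. -/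
def MertensUpperHalf : Prop :=
  ∀ ε : ℝ, 0 < ε → ∀ᶠ x : ℝ in atTop,
    ((∑ n ∈ Finset.Ioc 0 ⌊x⌋₊, ArithmeticFunction.moebius n : ℤ) : ℝ) ≤ x ^ (1 / 2 + ε)

/-- D-O lower half: `−x^{1/2+ε} ≤ M(x)` eventually, for every `ε > 0`. -/
def MertensLowerHalf : Prop :=
  ∀ ε : ℝ, 0 < ε → ∀ᶠ x : ℝ in atTop,
    -x ^ (1 / 2 + ε) ≤ ((∑ n ∈ Finset.Ioc 0 ⌊x⌋₊, ArithmeticFunction.moebius n : ℤ) : ℝ)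

/-- D-H low piece: RH for the zeros of the open strip of height `≤ T` (both signs of `Im`). -/
def RHUpToAbs (T : ℝ) : Prop :=
  ∀ s : ℂ, riemannZeta s = 0 → 0 < s.re → s.re < 1 → |s.im| ≤ T → s.re = 1 / 2

/-- D-H high piece: RH for the zeros of the open strip of height `> T`. -/
def RHAbove (T : ℝ) : Prop :=
  ∀ s : ℂ, riemannZeta s = 0 → 0 < s.re → s.re < 1 → T < |s.im| → s.re = 1 / 2

/-! ## §0 Calibration: `X ↔ RH` -/

/-- `StripThesis` is by definition "quasi-RH at every abscissa `> 1/2`". [folklore] -/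
theorem stripThesis_iff_forall_quasiRH :
    StripThesis ↔ ∀ σ₀ : ℝ, 1 / 2 < σ₀ → QuasiRiemannHypothesis σ₀ := Iff.rfl

/-- `X → RH` through the Literature facts (symmetry `ρ ↦ 1 − ρ`; Titchmarsh §2.12). [folklore] -/
theorem riemannHypothesis_of_stripThesis (hX : StripThesis) : RiemannHypothesis :=
  riemannHypothesis_of_forall_quasiRiemannHypothesis quasiRiemannHypothesis_one_half_iff_holds hX

/-- `RH → X` (a zero with `1/2 < σ₀ < Re s < 1` is neither trivial nor the pole). [folklore] -/
theorem stripThesis_of_riemannHypothesis (h : RiemannHypothesis) : StripThesis := by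
  intro σ₀ hσ₀ s hs h0 h1
  have hnt : ¬∃ n : ℕ, s = -2 * (n + 1) := by
    rintro ⟨n, hn⟩
    have := congrArg Complex.re hn
    simp at this
    linarith [n.cast_nonneg (α := ℝ)]
  have hs1 : s ≠ 1 := by
    rintro rfl
    simp at h1
  have := h s hs hnt hs1
  linarith

/-- Calibration. [folklore] -/
theorem stripThesis_iff_riemannHypothesis : StripThesis ↔ RiemannHypothesis :=
  ⟨riemannHypothesis_of_stripThesis, stripThesis_of_riemannHypothesis⟩

/-! ## D-A. Bridge split and dichotomy -/

/-- Assembly of D-A (TRIVIAL SEAM: modus ponens). [folklore] -/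
theorem stripThesis_of_strip_of_propagation (h₂ : StripZeroFreeStrip) (hP : StripPropagation) :
    StripThesis := hP h₂

/-- The bridge IS the dichotomy "no intermediate abscissa": `(#2 → X) ↔ (Θ⁺ ∉ (1/2,1))`. [folklore] -/
theorem stripPropagation_iff_stripDichotomy : StripPropagation ↔ StripDichotomy := by
  constructor
  · intro hP σ₀ hσ₀ hσ₁ hQ
    refine hP ⟨1 - σ₀, by linarith, ?_⟩
    intro s hs h0 h1
    exact hQ s hs (by linarith) h1
  · rintro hD ⟨δ, hδ, hQ⟩
    by_cases hle : 1 - δ ≤ 1 / 2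
    · intro σ₀ hσ₀ s hs h0 h1
      exact hQ s hs (by linarith) h1
    · push Not at hle
      exact hD (1 - δ) hle (by linarith) (fun s hs h0 h1 => hQ s hs h0 h1)

/-- RH-implied: the bridge holds in the RH world (trivially) … [folklore] -/
theorem stripPropagation_of_stripThesis (hX : StripThesis) : StripPropagation := fun _ => hX

/-- … and in the world `Θ⁺ = 1` (no zero-free strip at all): so `StripPropagation` is NOT
RH-equivalent unless `StripZeroFreeStrip` is a theorem. [folklore] -/
theorem stripPropagation_of_not_strip (h : ¬ StripZeroFreeStrip) : StripPropagation :=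
  fun h₂ => (h h₂).elim

/-! ## D-M. Mertens ε-form: a LANDED iff (restated one level down) -/

/-- `MertensHalf ↔ StripThesis` from the two discharged Littlewood-dictionary facts
(`mertens_isBigO_iff_forall_quasiRiemannHypothesis` at `θ = 1/2`); the instances `σ₀ ≥ 1` of X
are vacuous. [cite: Titchmarsh1986, Thm 14.25] -/
theorem mertensHalf_iff_stripThesis : MertensHalf ↔ StripThesis := by
  have key := mertens_isBigO_iff_forall_quasiRiemannHypothesis (θ := 1 / 2) le_rfl (by norm_num)
  have hM : MertensHalf ↔ ∀ ε : ℝ, 0 < ε →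
      (fun x : ℝ => (mertensFunction x : ℝ)) =O[atTop] fun x : ℝ => x ^ (1 / 2 + ε) := Iff.rfl
  rw [hM, key]
  constructor
  · intro h σ₀ hσ₀ s hs h0 h1
    by_cases hσ1 : σ₀ < 1
    · exact h σ₀ hσ₀ hσ1 s hs h0 h1
    · push Not at hσ1
      linarith
  · intro h θ' hθ' _
    exact h θ' hθ'

/-! ## D-O. One-sided halves -/

/-- Assembly of D-O: the two one-sided eventual bounds give the `O`-bound. [folklore] -/
theorem mertensHalf_of_upper_of_lower (hU : MertensUpperHalf) (hL : MertensLowerHalf) :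
    MertensHalf := by
  intro ε hε
  refine Asymptotics.IsBigO.of_bound 1 ?_
  filter_upwards [hU ε hε, hL ε hε, eventually_ge_atTop (0 : ℝ)] with x hxU hxL hx0
  rw [one_mul, Real.norm_eq_abs, Real.norm_eq_abs, abs_of_nonneg (Real.rpow_nonneg hx0 _)]
  exact abs_le.2 ⟨hxL, hxU⟩

/-- D-O reaches X (through the landed dictionary). [folklore] -/
theorem stripThesis_of_upper_of_lower (hU : MertensUpperHalf) (hL : MertensLowerHalf) :
    StripThesis :=
  mertensHalf_iff_stripThesis.1 (mertensHalf_of_upper_of_lower hU hL)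

/-! ## D-H. Height split -/

/-- Assembly of D-H (case split on the height). [folklore] -/
theorem stripThesis_of_upTo_of_above {T : ℝ} (hlow : RHUpToAbs T) (hhigh : RHAbove T) :
    StripThesis := by
  intro σ₀ hσ₀ s hs h0 h1
  have hre0 : 0 < s.re := by linarith
  by_cases hT : T < |s.im|
  · have := hhigh s hs hre0 h1 hT
    linarith
  · have := hlow s hs hre0 h1 (not_lt.1 hT)
    linarith

/-! ## D-R. RuelleBand's BC2 redirect, transported to X (landed) -/

/-- `NoRightInteriorBand → ZetaWeakRecurrence → StripThesis` (Rouché glue of route RuelleBand,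
landed as `riemannHypothesis_iff_noRightInteriorBand_and_weakRecurrence`). [cite: Bagchi1987, main theorem] -/
theorem stripThesis_of_nrib_of_wr (hN : NoRightInteriorBand) (hW : ZetaWeakRecurrence) :
    StripThesis :=
  stripThesis_of_riemannHypothesis
    (Summit.RiemannHypothesis.RiemannHypothesis.Theorems.NribWeakRecurrenceToExact.riemannHypothesis_iff_noRightInteriorBand_and_weakRecurrence.2
      ⟨hN, hW⟩)

/-- Lossless: `StripThesis ↔ NoRightInteriorBand ∧ ZetaWeakRecurrence`. [cite: Bagchi1987, main theorem] -/
theorem stripThesis_iff_nrib_and_wr : StripThesis ↔ NoRightInteriorBand ∧ ZetaWeakRecurrence :=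
  stripThesis_iff_riemannHypothesis.trans
    Summit.RiemannHypothesis.RiemannHypothesis.Theorems.NribWeakRecurrenceToExact.riemannHypothesis_iff_noRightInteriorBand_and_weakRecurrence

/-- In the 3-split `StripZeroFreeStrip ∧ NoRightInteriorBand ∧ ZetaWeakRecurrence → X` the Strip
piece is NOT load-bearing: the other two already give X. [folklore] -/
theorem strip_not_loadBearing_in_threeSplit :
    (NoRightInteriorBand → ZetaWeakRecurrence → StripThesis) := stripThesis_of_nrib_of_wr

end Summit.RiemannHypothesis.RiemannHypothesis.Cruxes.StripThesis.Strategist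

end
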